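import Literature.Geometry.Kaehler.CurveResidueTheorem
import Mathlib.Analysis.Complex.TaylorSeries
import Mathlib.Analysis.Analytic.Order
import Mathlib.LinearAlgebra.Dual.Lemmas
import HarnessLib

/-!
# `dim H^{1,0} ≤ g` on a compact complex curve with enough meromorphic functions

Family `hodge` / trunk Kähler, layer `Literature/Geometry/Kaehler`. Let `M` be a compact connected
complex manifold of complex dimension one (charts in the complex line `E`, `dim_ℂ E = 1`, with a
`ℂ`-linear coordinate `ℓ : E ≃ ℂ`), `p ∈ M`, and `g : ℕ`. Suppose that for every `N` there is a
`ℂ`-vector space `V_N` of functions `h : M → ℂ`, holomorphic on `M ∖ {p}`, with a pole of order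
`≤ N` at `p` (`h = (z − c)^{−N} G` near `c = z(p)` in the chart, `G` holomorphic), determined by
their values off `p`, and with `dim V_N ≥ N + 1 − g` — on an algebraic curve these are the
Riemann–Roch spaces `L(N·p)` with Riemann's inequality. Then (`rank_hodgePQ_one_one_zero_le`)

  **`dim H^{1,0}(M) ≤ g`**, for `H^{1,0} = hodgePQ E M 1 1 0 ⊆ H¹_dR(M; ℂ)`,

the span of the classes of the closed smooth `(1,0)`-forms; more precisely every
finite-dimensional space `W` of closed smooth `(1,0)`-forms has `dim W ≤ g`
(`finrank_le_of_forall_exists_poleSpace`).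

This is the inequality `dim H⁰(X, Ω¹) ≤ g` of the theory of compact Riemann surfaces (Forster,
*Lectures on Riemann Surfaces*, §16–§17; Griffiths–Harris, *Principles*, pp. 245, 273–277 —
Weierstrass gaps) in the form "residues pair holomorphic differentials against principal parts":

* for `ω ∈ W` the chart coefficient `A_ω` (`ω = A_ω dz`) is holomorphic
  (`differentiableOn_coeff`, `CurveResidueTheorem`), and for `N` large its `N`-jet at `c` is
  injective on `W` (`exists_forall_eq_zero_of_iteratedDeriv_eq_zero`: the kernels decrease and
  meet in `0` by the **identity theorem for closed `(1,0)`-forms**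
  `eq_zero_of_coeff_eventuallyEq_zero`, and `W` is finite-dimensional);
* for `h ∈ V_N` and `ω ∈ W`, **`Res_p(h ω) = 0`** — the one-pole residue theorem
  `residueAt_eq_zero_of_mdifferentiableAt` of `CurveResidueTheorem` (Stokes); with the Cauchy
  formula for Taylor coefficients as residues (`residueAt_zpow_negSucc_mul`) and Leibniz' rule this
  reads `∑_{i<N} c_{i−N}(h) · a_{N−1−i}(ω) = 0` (`residueAt_zpow_neg_mul_mul_eq_sum`): the Laurent
  jets of `V_N` and the Taylor jets of `W` are orthogonal for a perfect pairing on `ℂᴺ`, whence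
  `dim σ(V_N) + dim τ(W) ≤ N` (`finrank_add_finrank_le_of_sum_mul_rev_eq_zero`, duality);
* the Laurent-jet map `σ` on `V_N` has kernel the functions with a removable singularity at `p`
  (`exists_analyticAt_eventuallyEq_of_iteratedDeriv_eq_zero`), which extend to holomorphic
  functions on the compact connected `M`, hence are constant (Mathlib's
  `MDifferentiable.exists_eq_const_of_compactSpace`): `dim ker σ ≤ 1`;
* so `dim W = dim τ(W) ≤ N − (dim V_N − 1) ≤ g`.

Everything is proved (theorems only; no definitions, no named facts — D-0026). This is brick G-B of
the analytic half of `h^{1,0}(C) ≤ g(C)` for smooth projective curves (the residual of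
`Motives.two_mul_dim_eq_finrank_bettiCohomology`, see `AlgebraicGeometry/HodgeTheory/JacobianHodgeGenus`).

## References

* [FarkasKra1992] H. M. Farkas, I. Kra, Riemann Surfaces, 2nd ed., GTM 71 (1992), I.1.5, II.5.3,
  III.2–III.3 (residues, `dim` of holomorphic differentials).
* O. Forster, Lectures on Riemann Surfaces, GTM 81 (1981), Thm. 10.21 (residue theorem), §16–§17.
* [HormanderSCV1973] L. Hörmander, An Introduction to Complex Analysis in Several Variables (1973),
  Thm. 1.2.1 (Cauchy–Pompeiu; Taylor coefficients by Cauchy integrals).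
* [VoisinHodgeI2002] C. Voisin, Hodge Theory and Complex Algebraic Geometry I (2002), §2.3.1–2.3.3.
-/

noncomputable section

open scoped Manifold ContDiff Topology Nat
open Set Filter Complex MeasureTheory Metric Module
open Literature.Analysis.Complex Literature.NumberTheory.Transcendental

namespace Literature.Geometry.Kaehler

/-! ### Complex analysis in the plane: Taylor coefficients as residues -/

section Plane

/-- **Cauchy's formula for the Taylor coefficients as residues**:
`Res_c ((z − c)^{−(n+1)} F) = F⁽ⁿ⁾(c) / n!` for `F` holomorphic on a disc about `c` (the
coefficients of the Cauchy power series, Mathlib's `cauchyPowerSeries` and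
`HasFPowerSeriesOnBall.factorial_smul`). [folklore] -/
theorem residueAt_zpow_negSucc_mul {F : ℂ → ℂ} {c : ℂ} {R : ℝ} (hR : 0 < R)
    (hF : DifferentiableOn ℂ F (ball c R)) (n : ℕ) :
    residueAt (fun z ↦ (z - c) ^ (-(n + 1 : ℤ)) * F z) c = (n ! : ℂ)⁻¹ * iteratedDeriv n F c := by
  obtain ⟨r, hr0, hrR⟩ : ∃ r : NNReal, (0 : ℝ) < r ∧ (r : ℝ) < R :=
    ⟨⟨R / 2, by positivity⟩, half_pos hR, half_lt_self hR⟩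
  have hFc : DifferentiableOn ℂ F (closedBall c r) := hF.mono (closedBall_subset_ball hrR)
  have hps := hFc.hasFPowerSeriesOnBall (by exact_mod_cast hr0)
  have hfs := hps.factorial_smul (y := 1) n
  have hd : DifferentiableOn ℂ (fun z ↦ (z - c) ^ (-(n + 1 : ℤ)) * F z) (ball c R \ {c}) := by
    intro z hz
    have hzc : z - c ≠ 0 := sub_ne_zero.2 hz.2
    exact (((differentiableAt_id.sub_const c).zpow (Or.inl hzc)).mul
      (hF.differentiableAt (isOpen_ball.mem_nhds hz.1))).differentiableWithinAt
  have hfun : (fun z ↦ (1 / (z - c)) ^ n • (z - c)⁻¹ • F z) =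
      fun z ↦ (z - c) ^ (-(n + 1 : ℤ)) * F z := by
    funext z
    rw [smul_eq_mul, smul_eq_mul, ← mul_assoc, one_div, ← pow_succ, inv_pow,
      show (-(n + 1 : ℤ)) = -((n + 1 : ℕ) : ℤ) by push_cast; ring, zpow_neg, zpow_natCast]
  rw [residueAt_eq_circleResidue hd hr0 hrR, circleResidue, iteratedDeriv_eq_iteratedFDeriv, ← hfs,
    cauchyPowerSeries_apply, nsmul_eq_mul, smul_eq_mul, ← mul_assoc, ← mul_assoc,
    inv_mul_cancel₀ (by exact_mod_cast n.factorial_ne_zero : (n ! : ℂ) ≠ 0), one_mul, hfun]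

/-- **Taylor coefficients of an analytic germ as residues** (filter form): if `F` is analytic at
`c` then `Res_c ((z − c)^{−(n+1)} F) = F⁽ⁿ⁾(c)/n!`. [folklore] -/
theorem residueAt_zpow_negSucc_mul_of_analyticAt {F : ℂ → ℂ} {c : ℂ} (hF : AnalyticAt ℂ F c)
    (n : ℕ) :
    residueAt (fun z ↦ (z - c) ^ (-(n + 1 : ℤ)) * F z) c = (n ! : ℂ)⁻¹ * iteratedDeriv n F c := by
  obtain ⟨R, hR, hd⟩ := Metric.eventually_nhds_iff_ball.1
    (hF.eventually_analyticAt.mono fun z hz ↦ hz.differentiableAt)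
  exact residueAt_zpow_negSucc_mul hR (fun z hz ↦ (hd z hz).differentiableWithinAt) n

/-- **The residue pairing of a pole of order `≤ N` against a holomorphic germ**: for `G`, `A`
analytic at `c`,
`Res_c ((z − c)^{−N} G · A) = ∑_{i<N} (G⁽ⁱ⁾(c)/i!) · (A⁽ᴺ⁻¹⁻ⁱ⁾(c)/(N−1−i)!)`
(the coefficient of `(z − c)^{N−1}` in the product of the Taylor series; Leibniz' rule).
[folklore] -/
theorem residueAt_zpow_neg_mul_mul_eq_sum {G A : ℂ → ℂ} {c : ℂ} (hG : AnalyticAt ℂ G c)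
    (hA : AnalyticAt ℂ A c) (N : ℕ) :
    residueAt (fun z ↦ (z - c) ^ (-(N : ℤ)) * G z * A z) c =
      ∑ i : Fin N, ((i : ℕ)! : ℂ)⁻¹ * iteratedDeriv i G c *
        ((((Fin.rev i : Fin N) : ℕ)! : ℂ)⁻¹ * iteratedDeriv (Fin.rev i : Fin N) A c) := by
  cases N with
  | zero =>
    simp only [Finset.univ_eq_empty, Finset.sum_empty, CharP.cast_eq_zero, neg_zero, zpow_zero,
      one_mul]
    exact residueAt_of_analyticAt (hG.mul hA)
  | succ n =>
    have hGA : AnalyticAt ℂ (G * A) c := hG.mul hA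
    have h1 : residueAt (fun z ↦ (z - c) ^ (-(n + 1 : ℤ)) * G z * A z) c =
        (n ! : ℂ)⁻¹ * iteratedDeriv n (G * A) c := by
      rw [← residueAt_zpow_negSucc_mul_of_analyticAt hGA n]
      congr 1
      funext z
      rw [Pi.mul_apply, mul_assoc]
    rw [show ((n + 1 : ℕ) : ℤ) = (n + 1 : ℤ) by push_cast; ring, h1,
      iteratedDeriv_mul hG.contDiffAt hA.contDiffAt, Finset.mul_sum]
    simp only [Fin.val_rev]
    rw [Fin.sum_univ_eq_sum_range (fun i ↦ ((i ! : ℂ))⁻¹ * iteratedDeriv i G c *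
      (((n + 1 - (i + 1))! : ℂ)⁻¹ * iteratedDeriv (n + 1 - (i + 1)) A c)) (n + 1)]
    refine Finset.sum_congr rfl fun i hi ↦ ?_
    rw [Finset.mem_range] at hi
    have hi' : i ≤ n := Nat.lt_succ_iff.1 hi
    rw [Nat.cast_choose ℂ hi', show n + 1 - (i + 1) = n - i by omega]
    have h1 : (i ! : ℂ) ≠ 0 := by exact_mod_cast i.factorial_ne_zero
    have h2 : ((n - i)! : ℂ) ≠ 0 := by exact_mod_cast (n - i).factorial_ne_zero
    have h3 : (n ! : ℂ) ≠ 0 := by exact_mod_cast n.factorial_ne_zero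
    field_simp

/-- **Removable singularity from vanishing Taylor coefficients**: if `H = (z − c)^{−N} G` on a
punctured neighbourhood of `c` with `G` analytic and `G⁽ⁱ⁾(c) = 0` for `i < N`, then `H` agrees
with an analytic germ on a punctured neighbourhood (`G = (z − c)^N G₁`, Mathlib's
`natCast_le_analyticOrderAt_iff_iteratedDeriv_eq_zero`). [folklore] -/
theorem exists_analyticAt_eventuallyEq_of_iteratedDeriv_eq_zero {H G : ℂ → ℂ} {c : ℂ} {N : ℕ}
    (hG : AnalyticAt ℂ G c) (hH : ∀ᶠ z in 𝓝[≠] c, H z = (z - c) ^ (-(N : ℤ)) * G z)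
    (h0 : ∀ i < N, iteratedDeriv i G c = 0) :
    ∃ G₁ : ℂ → ℂ, AnalyticAt ℂ G₁ c ∧ H =ᶠ[𝓝[≠] c] G₁ := by
  obtain ⟨G₁, hG₁, hGG⟩ := (natCast_le_analyticOrderAt hG).1
    ((natCast_le_analyticOrderAt_iff_iteratedDeriv_eq_zero hG).2 h0)
  refine ⟨G₁, hG₁, ?_⟩
  filter_upwards [hH, hGG.filter_mono nhdsWithin_le_nhds, self_mem_nhdsWithin] with z hz hzG hzc
  rw [hz, hzG, smul_eq_mul, ← mul_assoc, zpow_neg, zpow_natCast,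
    inv_mul_cancel₀ (pow_ne_zero _ (sub_ne_zero.2 hzc)), one_mul]

/-- A function equal to `(z − c)^{−N} G` (`G` analytic at `c`) on a punctured neighbourhood of `c`
is complex-differentiable on a punctured neighbourhood of `c`. [folklore] -/
theorem eventually_differentiableAt_of_eventuallyEq_zpow_mul {H G : ℂ → ℂ} {c : ℂ} {N : ℤ}
    (hG : AnalyticAt ℂ G c) (hH : ∀ᶠ z in 𝓝[≠] c, H z = (z - c) ^ N * G z) :
    ∀ᶠ z in 𝓝[≠] c, DifferentiableAt ℂ H z := by
  have hGd : ∀ᶠ z in 𝓝[≠] c, DifferentiableAt ℂ G z :=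
    (hG.eventually_analyticAt.mono fun z hz ↦ hz.differentiableAt).filter_mono nhdsWithin_le_nhds
  filter_upwards [eventually_nhdsNE_eventually_nhds_iff.mpr hH, hGd, self_mem_nhdsWithin]
    with z hz hzG hzc
  refine DifferentiableAt.congr_of_eventuallyEq ?_ hz
  exact ((differentiableAt_id.sub_const c).zpow (Or.inl (sub_ne_zero.2 hzc))).mul hzG

end Plane

/-! ### Linear algebra: subspaces orthogonal under a perfect pairing -/

section LinearAlgebra

/-- **Two subspaces of `ℂᴺ` orthogonal for the dot product have `dim S + dim T ≤ N`** (the dot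
product identifies `ℂᴺ` with its dual, `T` lies in the co-annihilator of the image of `S`, and
`dim Φ + dim Φ^⊥ = N`, Mathlib's `Subspace.finrank_add_finrank_dualCoannihilator_eq`).
[folklore] -/
theorem finrank_add_finrank_le_of_sum_mul_eq_zero {N : ℕ} (S T : Submodule ℂ (Fin N → ℂ))
    (h : ∀ s ∈ S, ∀ t ∈ T, ∑ i, s i * t i = 0) : finrank ℂ S + finrank ℂ T ≤ N := by
  let D : (Fin N → ℂ) →ₗ[ℂ] Module.Dual ℂ (Fin N → ℂ) :=
    LinearMap.mk₂ ℂ (fun s t ↦ ∑ i, s i * t i)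
      (fun s₁ s₂ t ↦ by simp only [Pi.add_apply, add_mul, Finset.sum_add_distrib])
      (fun a s t ↦ by simp only [Pi.smul_apply, smul_eq_mul, mul_assoc, Finset.mul_sum])
      (fun s t₁ t₂ ↦ by simp only [Pi.add_apply, mul_add, Finset.sum_add_distrib])
      (fun a s t ↦ by simp only [Pi.smul_apply, smul_eq_mul, Finset.mul_sum, mul_left_comm])
  have hD : Function.Injective D := by
    intro s₁ s₂ h12
    funext j
    have h' := LinearMap.congr_fun h12 (Pi.single j 1)
    simpa [D, LinearMap.mk₂_apply, Pi.single_apply, mul_ite, Finset.sum_ite_eq'] using h'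
  have hT : T ≤ (S.map D).dualCoannihilator := by
    intro t ht
    rw [Submodule.mem_dualCoannihilator]
    rintro _ ⟨s, hs, rfl⟩
    exact h s hs t ht
  have h1 : finrank ℂ (S.map D) = finrank ℂ S :=
    (LinearEquiv.finrank_eq (Submodule.equivMapOfInjective D hD S)).symm
  have h2 := Subspace.finrank_add_finrank_dualCoannihilator_eq (S.map D)
  rw [Module.finrank_fin_fun] at h2
  calc finrank ℂ S + finrank ℂ T
      ≤ finrank ℂ (S.map D) + finrank ℂ (S.map D).dualCoannihilator := by
        rw [h1]; exact Nat.add_le_add_left (Submodule.finrank_mono hT) _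
    _ = N := h2

/-- The same for the pairing `∑ᵢ sᵢ t_{N−1−i}` (reverse the coordinates of `T`). [folklore] -/
theorem finrank_add_finrank_le_of_sum_mul_rev_eq_zero {N : ℕ} (S T : Submodule ℂ (Fin N → ℂ))
    (h : ∀ s ∈ S, ∀ t ∈ T, ∑ i, s i * t (Fin.rev i) = 0) : finrank ℂ S + finrank ℂ T ≤ N := by
  let R : (Fin N → ℂ) ≃ₗ[ℂ] (Fin N → ℂ) := LinearEquiv.funCongrLeft ℂ ℂ Fin.revPerm
  have h' : ∀ s ∈ S, ∀ t ∈ T.map (R : (Fin N → ℂ) →ₗ[ℂ] (Fin N → ℂ)), ∑ i, s i * t i = 0 := by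
    rintro s hs _ ⟨t, ht, rfl⟩
    simpa [R, LinearEquiv.funCongrLeft_apply, LinearMap.funLeft_apply] using h s hs t ht
  have h2 := finrank_add_finrank_le_of_sum_mul_eq_zero S _ h'
  rwa [LinearEquiv.finrank_map_eq] at h2

end LinearAlgebra

/-! ### Closed `(1,0)`-forms on a complex curve: the identity theorem -/

section Curve

variable {E : Type*} [NormedAddCommGroup E] [NormedSpace ℂ E]
  {M : Type*} [TopologicalSpace M] [ChartedSpace E M]
  [IsManifold 𝓘(ℂ, E) ω M] [IsManifold 𝓘(ℝ, E) ∞ M]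

/-- **A `(1,0)`-form vanishes where its chart coefficient does**: if `A(y) = Ω(y)(ℓ⁻¹ 1) = 0`
(`Ω = α.inChart x₀`) at a point `y` of the chart target, then `α = 0` at the corresponding point
of `M` (`Ω(y)(v) = A(y) ℓ(v)` and `Ω(y) = α(z) ∘ T` with `T` invertible). [folklore] -/
theorem apply_eq_zero_of_coeff_eq_zero {α : MForm 𝓘(ℝ, E) M ℂ 1} (hωt : IsOfType 1 0 α)
    (ℓ : E ≃L[ℂ] ℂ) {x₀ : M} {y : E} (hy : y ∈ (extChartAt 𝓘(ℝ, E) x₀).target)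
    (h0 : α.inChart x₀ y ![ℓ.symm 1] = 0) : α ((extChartAt 𝓘(ℝ, E) x₀).symm y) = 0 := by
  set z := (extChartAt 𝓘(ℝ, E) x₀).symm y with hz
  have hin : ∀ v : E, α.inChart x₀ y ![v] = 0 := fun v ↦ by
    rw [inChart_apply_eq_mul hωt ℓ hy, h0, zero_mul]
  have hin0 : α.inChart x₀ y = 0 := by
    ext v
    rw [oneForm_apply_eq, ContinuousAlternatingMap.coe_zero, Pi.zero_apply]
    exact hin (v 0)
  have hzs : z ∈ (extChartAt 𝓘(ℝ, E) x₀).source := (extChartAt 𝓘(ℝ, E) x₀).map_target hy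
  have hzz : (extChartAt 𝓘(ℝ, E) z).symm (extChartAt 𝓘(ℝ, E) z z) = z := extChartAt_to_inv z
  have h₁ : (extChartAt 𝓘(ℝ, E) z).symm (extChartAt 𝓘(ℝ, E) z z) ∈ (extChartAt 𝓘(ℝ, E) x₀).source := by
    rw [hzz]; exact hzs
  have hzy : extChartAt 𝓘(ℝ, E) x₀ z = y := (extChartAt 𝓘(ℝ, E) x₀).right_inv hy
  rw [← MForm.inChart_apply_self α z, MForm.inChart_eq_comp_inChart α (mem_extChartAt_target z) h₁,
    hzz, hzy, hin0]
  ext v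
  simp only [ContinuousAlternatingMap.compContinuousLinearMap_apply,
    ContinuousAlternatingMap.coe_zero, Pi.zero_apply]
  rfl

omit [IsManifold 𝓘(ℂ, E) ω M] [IsManifold 𝓘(ℝ, E) ∞ M] in
/-- **Where the form vanishes identically, so does its chart coefficient**: if `α = 0` near a point
`x` of the source of the chart at `x₀`, then `z ↦ Ω(ℓ⁻¹ z)(ℓ⁻¹ 1)` vanishes near `ℓ (chart x)`.
[folklore] -/
theorem coeff_eventuallyEq_zero_of_eventuallyEq_zero (α : MForm 𝓘(ℝ, E) M ℂ 1) (ℓ : E ≃L[ℂ] ℂ)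
    {x₀ x : M} (hx : x ∈ (extChartAt 𝓘(ℝ, E) x₀).source) (h0 : ∀ᶠ x' in 𝓝 x, α x' = 0) :
    ∀ᶠ z in 𝓝 (ℓ (extChartAt 𝓘(ℝ, E) x₀ x)), α.inChart x₀ (ℓ.symm z) ![ℓ.symm 1] = 0 := by
  have hxx : (extChartAt 𝓘(ℝ, E) x₀).symm (ℓ.symm (ℓ (extChartAt 𝓘(ℝ, E) x₀ x))) = x := by
    rw [ℓ.symm_apply_apply, (extChartAt 𝓘(ℝ, E) x₀).left_inv hx]
  have hc : ContinuousAt (fun z ↦ (extChartAt 𝓘(ℝ, E) x₀).symm (ℓ.symm z))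
      (ℓ (extChartAt 𝓘(ℝ, E) x₀ x)) := by
    refine ContinuousAt.comp ?_ ℓ.symm.continuous.continuousAt
    rw [ℓ.symm_apply_apply]
    exact continuousAt_extChartAt_symm' hx
  have h0x : ∀ᶠ x' in 𝓝 ((extChartAt 𝓘(ℝ, E) x₀).symm (ℓ.symm (ℓ (extChartAt 𝓘(ℝ, E) x₀ x)))),
      α x' = 0 := by
    rwa [hxx]
  have h0' : ∀ᶠ z in 𝓝 (ℓ (extChartAt 𝓘(ℝ, E) x₀ x)),
      α ((extChartAt 𝓘(ℝ, E) x₀).symm (ℓ.symm z)) = 0 :=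
    hc.eventually (p := fun x' ↦ α x' = 0) h0x
  filter_upwards [h0'] with z hz
  rw [MForm.inChart_apply, hz, ContinuousAlternatingMap.coe_zero, Pi.zero_apply]

/-- **Identity theorem for closed `(1,0)`-forms on a connected complex curve**: if the chart
coefficient `A(z) = Ω(ℓ⁻¹ z)(ℓ⁻¹ 1)` of a smooth closed `(1,0)`-form `α` in the chart at `p`
vanishes near `ℓ (chart p)`, then `α = 0` (the set where `α` vanishes identically is open, and
closed by the identity theorem for the holomorphic coefficients `differentiableOn_coeff`).
[cite: FarkasKra1992, I.1.5 and II.5.3] -/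
theorem eq_zero_of_coeff_eventuallyEq_zero [PreconnectedSpace M] {α : MForm 𝓘(ℝ, E) M ℂ 1}
    (hωs : IsSmoothForm α) (hωc : IsClosedForm α) (hωt : IsOfType 1 0 α) (ℓ : E ≃L[ℂ] ℂ) {p : M}
    (h0 : ∀ᶠ z in 𝓝 (ℓ (extChartAt 𝓘(ℝ, E) p p)), α.inChart p (ℓ.symm z) ![ℓ.symm 1] = 0) :
    α = 0 := by
  -- local step: coefficient vanishing near `ℓ (chart x x)` ⇒ `α = 0` near `x`
  have hloc : ∀ x : M,
      (∀ᶠ z in 𝓝 (ℓ (extChartAt 𝓘(ℝ, E) x x)), α.inChart x (ℓ.symm z) ![ℓ.symm 1] = 0) →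
      ∀ᶠ x' in 𝓝 x, α x' = 0 := by
    intro x hx
    have hc : ContinuousAt (fun x' ↦ ℓ (extChartAt 𝓘(ℝ, E) x x')) x :=
      ℓ.continuous.continuousAt.comp (continuousAt_extChartAt x)
    have h1 : ∀ᶠ x' in 𝓝 x, α.inChart x (ℓ.symm (ℓ (extChartAt 𝓘(ℝ, E) x x'))) ![ℓ.symm 1] = 0 :=
      hc.eventually hx
    filter_upwards [h1, extChartAt_source_mem_nhds (I := 𝓘(ℝ, E)) x] with x' h1 hx'
    rw [ℓ.symm_apply_apply] at h1
    have h2 := apply_eq_zero_of_coeff_eq_zero hωt ℓ ((extChartAt 𝓘(ℝ, E) x).map_source hx') h1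
    rwa [(extChartAt 𝓘(ℝ, E) x).left_inv hx'] at h2
  set S : Set M := {x | ∀ᶠ x' in 𝓝 x, α x' = 0} with hS
  have hSo : IsOpen S := isOpen_setOf_eventually_nhds
  have hSc : IsClosed S := by
    rw [← closure_subset_iff_isClosed]
    intro x hx
    set ch := extChartAt 𝓘(ℝ, E) x with hch
    have hUo : IsOpen (ℓ.symm ⁻¹' ch.target) :=
      (isOpen_extChartAt_target x).preimage ℓ.symm.continuous
    have hcU : ℓ (ch x) ∈ ℓ.symm ⁻¹' ch.target := by
      show ℓ.symm (ℓ (ch x)) ∈ ch.target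
      rw [ℓ.symm_apply_apply]
      exact mem_extChartAt_target x
    obtain ⟨ε, hε, hball⟩ := Metric.isOpen_iff.1 hUo _ hcU
    have hA : AnalyticOnNhd ℂ (fun z ↦ α.inChart x (ℓ.symm z) ![ℓ.symm 1]) (ball (ℓ (ch x)) ε) :=
      ((differentiableOn_coeff hωs hωc hωt ℓ x).mono hball).analyticOnNhd isOpen_ball
    set O : Set M := ch.source ∩ (fun x' ↦ ℓ (ch x')) ⁻¹' ball (ℓ (ch x)) ε with hO
    have hOo : IsOpen O :=
      (ℓ.continuous.comp_continuousOn (continuousOn_extChartAt x)).isOpen_inter_preimage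
        (isOpen_extChartAt_source x) isOpen_ball
    have hxO : x ∈ O := ⟨mem_extChartAt_source x, mem_ball_self hε⟩
    obtain ⟨x', hx'O, hx'S⟩ : (O ∩ S).Nonempty := mem_closure_iff.1 hx O hOo hxO
    have h1 := coeff_eventuallyEq_zero_of_eventuallyEq_zero α ℓ hx'O.1 hx'S
    have h2 := hA.eqOn_zero_of_preconnected_of_eventuallyEq_zero (convex_ball _ _).isPreconnected
      hx'O.2 h1
    refine hloc x ?_
    filter_upwards [isOpen_ball.mem_nhds (mem_ball_self hε)] with z hz using h2 hz
  have hpS : p ∈ S := hloc p h0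
  have hSu : S = univ := IsClopen.eq_univ ⟨hSc, hSo⟩ ⟨p, hpS⟩
  funext x
  have hx : x ∈ S := hSu ▸ mem_univ x
  exact hx.self_of_nhds

/-- **A closed `(1,0)`-form on a connected complex curve with vanishing Taylor jet at one point is
zero**: if all derivatives `A⁽ⁱ⁾(c)` of the chart coefficient at `c = ℓ (chart p)` vanish, then
`α = 0` (the coefficient is analytic, so it vanishes near `c`; then the identity theorem
`eq_zero_of_coeff_eventuallyEq_zero`). [cite: FarkasKra1992, I.1.5 and II.5.3] -/
theorem eq_zero_of_forall_iteratedDeriv_coeff_eq_zero [PreconnectedSpace M]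
    {α : MForm 𝓘(ℝ, E) M ℂ 1} (hωs : IsSmoothForm α) (hωc : IsClosedForm α) (hωt : IsOfType 1 0 α)
    (ℓ : E ≃L[ℂ] ℂ) {p : M}
    (h0 : ∀ i : ℕ, iteratedDeriv i (fun z ↦ α.inChart p (ℓ.symm z) ![ℓ.symm 1])
      (ℓ (extChartAt 𝓘(ℝ, E) p p)) = 0) :
    α = 0 := by
  set c := ℓ (extChartAt 𝓘(ℝ, E) p p) with hc
  have hUo : IsOpen (ℓ.symm ⁻¹' (extChartAt 𝓘(ℝ, E) p).target) :=
    (isOpen_extChartAt_target p).preimage ℓ.symm.continuous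
  have hcU : c ∈ ℓ.symm ⁻¹' (extChartAt 𝓘(ℝ, E) p).target := by
    show ℓ.symm (ℓ (extChartAt 𝓘(ℝ, E) p p)) ∈ (extChartAt 𝓘(ℝ, E) p).target
    rw [ℓ.symm_apply_apply]
    exact mem_extChartAt_target p
  have hA : AnalyticAt ℂ (fun z ↦ α.inChart p (ℓ.symm z) ![ℓ.symm 1]) c :=
    (differentiableOn_coeff hωs hωc hωt ℓ p).analyticAt (hUo.mem_nhds hcU)
  have htop : analyticOrderAt (fun z ↦ α.inChart p (ℓ.symm z) ![ℓ.symm 1]) c = ⊤ := by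
    by_contra hne
    obtain ⟨n, hn⟩ := ENat.ne_top_iff_exists.1 hne
    have hle : ((n + 1 : ℕ) : ℕ∞) ≤ analyticOrderAt (fun z ↦ α.inChart p (ℓ.symm z) ![ℓ.symm 1]) c :=
      (natCast_le_analyticOrderAt_iff_iteratedDeriv_eq_zero hA).2 fun i _ ↦ h0 i
    rw [← hn] at hle
    have : n + 1 ≤ n := by exact_mod_cast hle
    omega
  rw [analyticOrderAt_eq_top] at htop
  exact eq_zero_of_coeff_eventuallyEq_zero hωs hωc hωt ℓ htop

end Curve

/-! ### The count: `dim W ≤ g` for spaces of closed `(1,0)`-forms -/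

section Count

variable {E : Type*} [NormedAddCommGroup E] [NormedSpace ℂ E] [FiniteDimensional ℂ E]
  [MeasurableSpace E] [BorelSpace E]
  {M : Type*} [TopologicalSpace M] [ChartedSpace E M]
  [IsManifold 𝓘(ℂ, E) ω M] [IsManifold 𝓘(ℝ, E) ∞ M] [T2Space M] [CompactSpace M]
  [PreconnectedSpace M]

omit [FiniteDimensional ℂ E] [MeasurableSpace E] [BorelSpace E] [IsManifold 𝓘(ℂ, E) ω M]
  [IsManifold 𝓘(ℝ, E) ∞ M] [T2Space M] [CompactSpace M] [PreconnectedSpace M] in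
/-- The chart coefficient `A(z) = Ω(ℓ⁻¹ z)(ℓ⁻¹ 1)` is `ℂ`-homogeneous in the form. [folklore] -/
theorem coeff_smul (a : ℂ) (α : MForm 𝓘(ℝ, E) M ℂ 1) (ℓ : E ≃L[ℂ] ℂ) (p : M) :
    (fun z ↦ (a • α).inChart p (ℓ.symm z) ![ℓ.symm 1]) =
      fun z ↦ a * α.inChart p (ℓ.symm z) ![ℓ.symm 1] := by
  funext z
  rfl

omit [FiniteDimensional ℂ E] [MeasurableSpace E] [BorelSpace E] [T2Space M] [CompactSpace M]
  [PreconnectedSpace M] in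
/-- The chart coefficient of a smooth closed `(1,0)`-form is analytic at the chart point.
[cite: VoisinHodgeI2002, §2.3.1–2.3.3] -/
theorem analyticAt_coeff {α : MForm 𝓘(ℝ, E) M ℂ 1} (hωs : IsSmoothForm α) (hωc : IsClosedForm α)
    (hωt : IsOfType 1 0 α) (ℓ : E ≃L[ℂ] ℂ) (p : M) :
    AnalyticAt ℂ (fun z ↦ α.inChart p (ℓ.symm z) ![ℓ.symm 1]) (ℓ (extChartAt 𝓘(ℝ, E) p p)) := by
  have hUo : IsOpen (ℓ.symm ⁻¹' (extChartAt 𝓘(ℝ, E) p).target) :=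
    (isOpen_extChartAt_target p).preimage ℓ.symm.continuous
  have hcU : ℓ (extChartAt 𝓘(ℝ, E) p p) ∈ ℓ.symm ⁻¹' (extChartAt 𝓘(ℝ, E) p).target := by
    show ℓ.symm (ℓ (extChartAt 𝓘(ℝ, E) p p)) ∈ (extChartAt 𝓘(ℝ, E) p).target
    rw [ℓ.symm_apply_apply]
    exact mem_extChartAt_target p
  exact (differentiableOn_coeff hωs hωc hωt ℓ p).analyticAt (hUo.mem_nhds hcU)

omit [FiniteDimensional ℂ E] [MeasurableSpace E] [BorelSpace E] [T2Space M] [CompactSpace M] in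
/-- **Finitely many Taylor coefficients at one point detect a finite-dimensional space of closed
`(1,0)`-forms**: for a finite-dimensional `W`, there is `N` such that a member of `W` whose chart
coefficient has vanishing derivatives of orders `< N` at `c = ℓ (chart p)` is zero (the kernels
decrease with `N` and meet in `0` by `eq_zero_of_forall_iteratedDeriv_coeff_eq_zero`; a decreasing
sequence of subspaces of a finite-dimensional space is stationary). [folklore] -/
theorem exists_forall_eq_zero_of_iteratedDeriv_eq_zero (ℓ : E ≃L[ℂ] ℂ) (p : M)
    (W : Submodule ℂ (MForm 𝓘(ℝ, E) M ℂ 1)) [FiniteDimensional ℂ W]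
    (hW : ∀ α ∈ W, IsSmoothForm α ∧ IsClosedForm α ∧ IsOfType 1 0 α) :
    ∃ N : ℕ, ∀ α ∈ W, (∀ i < N, iteratedDeriv i (fun z ↦ α.inChart p (ℓ.symm z) ![ℓ.symm 1])
      (ℓ (extChartAt 𝓘(ℝ, E) p p)) = 0) → α = 0 := by
  classical
  set c := ℓ (extChartAt 𝓘(ℝ, E) p p) with hc
  have han : ∀ α ∈ W, AnalyticAt ℂ (fun z ↦ α.inChart p (ℓ.symm z) ![ℓ.symm 1]) c := fun α hα ↦
    analyticAt_coeff (hW α hα).1 (hW α hα).2.1 (hW α hα).2.2 ℓ p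
  let K : ℕ → Submodule ℂ (MForm 𝓘(ℝ, E) M ℂ 1) := fun N ↦
    { carrier := {α | α ∈ W ∧
        ∀ i < N, iteratedDeriv i (fun z ↦ α.inChart p (ℓ.symm z) ![ℓ.symm 1]) c = 0}
      add_mem' := by
        rintro α β ⟨hα, hα0⟩ ⟨hβ, hβ0⟩
        refine ⟨W.add_mem hα hβ, fun i hi ↦ ?_⟩
        simp only [MForm.inChart_add, Pi.add_apply, ContinuousAlternatingMap.add_apply]
        rw [iteratedDeriv_fun_add (han α hα).contDiffAt (han β hβ).contDiffAt, hα0 i hi, hβ0 i hi,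
          add_zero]
      zero_mem' := ⟨W.zero_mem, fun i hi ↦ by simp [MForm.inChart_zero]⟩
      smul_mem' := by
        rintro a α ⟨hα, hα0⟩
        refine ⟨W.smul_mem a hα, fun i hi ↦ ?_⟩
        rw [coeff_smul, iteratedDeriv_const_mul a (han α hα).contDiffAt, hα0 i hi, mul_zero] }
  have hKle : ∀ N, K N ≤ W := fun N α hα ↦ hα.1
  haveI : ∀ N, FiniteDimensional ℂ (K N) := fun N ↦ Submodule.finiteDimensional_of_le (hKle N)
  have hanti : ∀ N N', N ≤ N' → K N' ≤ K N := fun N N' h α hα ↦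
    ⟨hα.1, fun i hi ↦ hα.2 i (lt_of_lt_of_le hi h)⟩
  have hex : ∃ m, ∃ N, finrank ℂ (K N) = m := ⟨_, 0, rfl⟩
  obtain ⟨N, hN⟩ := Nat.find_spec hex
  have hmin : ∀ N', finrank ℂ (K N) ≤ finrank ℂ (K N') := fun N' ↦ by
    rw [hN]; exact Nat.find_min' hex ⟨N', rfl⟩
  have heq : ∀ N', N ≤ N' → K N' = K N := fun N' h ↦
    Submodule.eq_of_le_of_finrank_le (hanti N N' h) (hmin N')
  refine ⟨N, fun α hα h0 ↦ ?_⟩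
  have hmem : α ∈ K N := ⟨hα, h0⟩
  refine eq_zero_of_forall_iteratedDeriv_coeff_eq_zero (hW α hα).1 (hW α hα).2.1 (hW α hα).2.2 ℓ
    (p := p) fun i ↦ ?_
  have hi : α ∈ K (max N (i + 1)) := by rw [heq _ (le_max_left _ _)]; exact hmem
  exact hi.2 i (lt_of_lt_of_le (Nat.lt_succ_self i) (le_max_right _ _))

/-- **`dim W ≤ g` for every finite-dimensional space `W` of closed smooth `(1,0)`-forms on a
compact connected complex curve carrying, for every `N`, a space `V_N` of functions holomorphic off
one point `p` with a pole of order `≤ N` at `p` and `dim V_N ≥ N + 1 − g`.** This is the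
analytic half of `dim H⁰(C, Ω¹) ≤ g` (Riemann's inequality `ℓ(NP) ≥ N + 1 − g` supplies `V_N`):
for `N` large the `N`-jet at `p` of the chart coefficient `A_ω` is injective on `W`
(`exists_forall_eq_zero_of_iteratedDeriv_eq_zero`); by the residue theorem
`residueAt_eq_zero_of_mdifferentiableAt`, `Res_p(hω) = 0` for `h ∈ V_N`, `ω ∈ W`, i.e. the Laurent
jets of `V_N` and the Taylor jets of `W` are orthogonal for the perfect pairing
`∑ c_{−i−1} a_i` on `ℂᴺ` (`residueAt_zpow_neg_mul_mul_eq_sum`); the Laurent-jet map on `V_N` has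
kernel the functions holomorphic at `p` too, which are constant (maximum principle,
`MDifferentiable.exists_eq_const_of_compactSpace`), of dimension `≤ 1`; hence
`dim W ≤ N − (dim V_N − 1) ≤ g`. (Forster, *Lectures on Riemann Surfaces*, §16–§17: the residue
pairing between `H⁰(Ω)` and principal parts; Griffiths–Harris, pp. 273–277, Weierstrass gaps.)
[cite: FarkasKra1992, I.1.5 and II.5.3] [cite: HormanderSCV1973, Thm. 1.2.1] -/
theorem finrank_le_of_forall_exists_poleSpace (h1 : finrank ℂ E = 1) [Fact (finrank ℝ E = 2)]
    (ℓ : E ≃L[ℂ] ℂ) (p : M) {g : ℕ}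
    (hV : ∀ N : ℕ, ∃ V : Submodule ℂ (M → ℂ),
      (∀ h ∈ V, ∀ x, x ≠ p → MDifferentiableAt 𝓘(ℂ, E) 𝓘(ℂ, ℂ) h x) ∧
      (∀ h ∈ V, ∃ G : ℂ → ℂ, AnalyticAt ℂ G (ℓ (extChartAt 𝓘(ℝ, E) p p)) ∧
        ∀ᶠ z in 𝓝[≠] (ℓ (extChartAt 𝓘(ℝ, E) p p)),
          h ((extChartAt 𝓘(ℝ, E) p).symm (ℓ.symm z)) =
            (z - ℓ (extChartAt 𝓘(ℝ, E) p p)) ^ (-(N : ℤ)) * G z) ∧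
      (∀ h ∈ V, (∀ x, x ≠ p → h x = 0) → h = 0) ∧
      FiniteDimensional ℂ V ∧ N + 1 ≤ finrank ℂ V + g)
    (W : Submodule ℂ (MForm 𝓘(ℝ, E) M ℂ 1)) [FiniteDimensional ℂ W]
    (hW : ∀ α ∈ W, IsSmoothForm α ∧ IsClosedForm α ∧ IsOfType 1 0 α) :
    finrank ℂ W ≤ g := by
  classical
  set ch := extChartAt 𝓘(ℝ, E) p with hch
  set c := ℓ (ch p) with hc
  obtain ⟨N, hN⟩ := exists_forall_eq_zero_of_iteratedDeriv_eq_zero ℓ p W hW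
  obtain ⟨V, hV1, hV2, hV3, hVfin, hVdim⟩ := hV N
  haveI := hVfin
  have han : ∀ α ∈ W, AnalyticAt ℂ (fun z ↦ α.inChart p (ℓ.symm z) ![ℓ.symm 1]) c := fun α hα ↦
    analyticAt_coeff (hW α hα).1 (hW α hα).2.1 (hW α hα).2.2 ℓ p
  -- Taylor jets of `W`
  let τ : W →ₗ[ℂ] (Fin N → ℂ) :=
    { toFun := fun w i ↦ ((i : ℕ)! : ℂ)⁻¹ *
        iteratedDeriv i (fun z ↦ (w : MForm 𝓘(ℝ, E) M ℂ 1).inChart p (ℓ.symm z) ![ℓ.symm 1]) c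
      map_add' := fun w₁ w₂ ↦ by
        funext i
        rw [Pi.add_apply, Submodule.coe_add]
        simp only [MForm.inChart_add, Pi.add_apply, ContinuousAlternatingMap.add_apply]
        rw [iteratedDeriv_fun_add (han _ w₁.2).contDiffAt (han _ w₂.2).contDiffAt, mul_add]
      map_smul' := fun a w ↦ by
        funext i
        rw [Pi.smul_apply, RingHom.id_apply, Submodule.coe_smul, coeff_smul,
          iteratedDeriv_const_mul a (han _ w.2).contDiffAt, smul_eq_mul, mul_left_comm] }
  have hτ : Function.Injective τ := by
    refine (injective_iff_map_eq_zero τ).2 fun w hw ↦ Subtype.ext (hN w w.2 fun i hi ↦ ?_)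
    have h := congr_fun hw ⟨i, hi⟩
    simp only [τ, LinearMap.coe_mk, AddHom.coe_mk, Pi.zero_apply, mul_eq_zero, inv_eq_zero,
      Nat.cast_eq_zero] at h
    exact h.resolve_left (Nat.factorial_ne_zero i)
  -- differentiability of the pole functions on a punctured neighbourhood
  have hHd : ∀ v ∈ V, ∀ m : ℤ, ∀ᶠ z in 𝓝[≠] c,
      DifferentiableAt ℂ (fun z ↦ (z - c) ^ m * v (ch.symm (ℓ.symm z))) z := by
    intro v hv m
    obtain ⟨G, hG, hvG⟩ := hV2 v hv
    have hd := eventually_differentiableAt_of_eventuallyEq_zpow_mul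
      (H := fun z ↦ v (ch.symm (ℓ.symm z))) hG hvG
    filter_upwards [hd, self_mem_nhdsWithin] with z hz hzc
    exact ((differentiableAt_id.sub_const c).zpow (Or.inl (sub_ne_zero.2 hzc))).mul hz
  -- Laurent jets of `V`
  let σ : V →ₗ[ℂ] (Fin N → ℂ) :=
    { toFun := fun v i ↦
        residueAt (fun z ↦ (z - c) ^ ((N : ℤ) - (i + 1 : ℕ)) * (v : M → ℂ) (ch.symm (ℓ.symm z))) c
      map_add' := fun v₁ v₂ ↦ by
        funext i
        rw [Pi.add_apply, ← residueAt_add (hHd _ v₁.2 _) (hHd _ v₂.2 _)]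
        congr 1
        funext z
        simp only [Submodule.coe_add, Pi.add_apply, mul_add]
      map_smul' := fun a v ↦ by
        funext i
        rw [Pi.smul_apply, RingHom.id_apply, smul_eq_mul, ← residueAt_const_mul (hHd _ v.2 _) a]
        congr 1
        funext z
        simp only [Submodule.coe_smul, Pi.smul_apply, smul_eq_mul, mul_left_comm] }
  -- the Laurent jets are the Taylor coefficients of `G`
  have hσG : ∀ v ∈ V, ∀ G : ℂ → ℂ, AnalyticAt ℂ G c →
      (∀ᶠ z in 𝓝[≠] c, v (ch.symm (ℓ.symm z)) = (z - c) ^ (-(N : ℤ)) * G z) → ∀ i : ℕ,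
      residueAt (fun z ↦ (z - c) ^ ((N : ℤ) - (i + 1 : ℕ)) * v (ch.symm (ℓ.symm z))) c =
        ((i)! : ℂ)⁻¹ * iteratedDeriv i G c := by
    intro v hv G hG hvG i
    rw [← residueAt_zpow_negSucc_mul_of_analyticAt hG i]
    have hGd : ∀ᶠ z in 𝓝[≠] c, DifferentiableAt ℂ (fun z ↦ (z - c) ^ (-(i + 1 : ℤ)) * G z) z := by
      have hGd' : ∀ᶠ z in 𝓝[≠] c, DifferentiableAt ℂ G z :=
        (hG.eventually_analyticAt.mono fun z hz ↦ hz.differentiableAt).filter_mono nhdsWithin_le_nhds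
      filter_upwards [hGd', self_mem_nhdsWithin] with z hz hzc
      exact ((differentiableAt_id.sub_const c).zpow (Or.inl (sub_ne_zero.2 hzc))).mul hz
    refine residueAt_congr hGd ?_
    filter_upwards [hvG, self_mem_nhdsWithin] with z hz hzc
    rw [hz, ← mul_assoc, ← zpow_add₀ (sub_ne_zero.2 hzc)]
    congr 2
    push_cast
    ring
  -- the pairing: residues of `h ω` vanish
  have hpair : ∀ s ∈ LinearMap.range σ, ∀ t ∈ LinearMap.range τ, ∑ i, s i * t (Fin.rev i) = 0 := by
    rintro _ ⟨v, rfl⟩ _ ⟨w, rfl⟩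
    obtain ⟨G, hG, hvG⟩ := hV2 v v.2
    obtain ⟨hws, hwc, hwt⟩ := hW w w.2
    have hmer : MeromorphicAt (fun z ↦ (v : M → ℂ) (ch.symm (ℓ.symm z))) c := by
      have hm : MeromorphicAt (fun z ↦ (z - c) ^ (-(N : ℤ)) * G z) c :=
        ((MeromorphicAt.id c).sub (MeromorphicAt.const c c)).zpow _ |>.mul hG.meromorphicAt
      exact hm.congr (hvG.mono fun z hz ↦ hz.symm)
    have hres := residueAt_eq_zero_of_mdifferentiableAt h1 ℓ p (hV1 v v.2) hws hwc hwt hmer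
    have hres' : residueAt (fun z ↦ (z - c) ^ (-(N : ℤ)) * G z *
        (w : MForm 𝓘(ℝ, E) M ℂ 1).inChart p (ℓ.symm z) ![ℓ.symm 1]) c = 0 := by
      rw [← hres]
      refine residueAt_congr ?_ ?_
      · have hvd := eventually_differentiableAt_of_eventuallyEq_zpow_mul
          (H := fun z ↦ (v : M → ℂ) (ch.symm (ℓ.symm z))) hG hvG
        have hAd : ∀ᶠ z in 𝓝[≠] c, DifferentiableAt ℂ
            (fun z ↦ (w : MForm 𝓘(ℝ, E) M ℂ 1).inChart p (ℓ.symm z) ![ℓ.symm 1]) z :=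
          ((han _ w.2).eventually_analyticAt.mono fun z hz ↦ hz.differentiableAt).filter_mono
            nhdsWithin_le_nhds
        filter_upwards [hvd, hAd] with z hzv hzA
        exact hzv.mul hzA
      · filter_upwards [hvG] with z hz
        rw [hz]
    rw [residueAt_zpow_neg_mul_mul_eq_sum hG (han _ w.2) N] at hres'
    rw [← hres']
    refine Finset.sum_congr rfl fun i _ ↦ ?_
    simp only [σ, τ, LinearMap.coe_mk, AddHom.coe_mk]
    rw [hσG v v.2 G hG hvG i]
  -- a point other than `p`
  obtain ⟨x₀, hx₀⟩ : ∃ x₀ : M, x₀ ≠ p := by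
    have hUo : IsOpen (ℓ.symm ⁻¹' ch.target) :=
      (isOpen_extChartAt_target p).preimage ℓ.symm.continuous
    have hcU : c ∈ ℓ.symm ⁻¹' ch.target := by
      show ℓ.symm (ℓ (ch p)) ∈ ch.target
      rw [ℓ.symm_apply_apply]
      exact mem_extChartAt_target p
    obtain ⟨ε, hε, hball⟩ := Metric.isOpen_iff.1 hUo c hcU
    have hmem : ℓ.symm (c + (ε / 2 : ℝ)) ∈ ch.target := by
      refine hball ?_
      rw [mem_ball, dist_eq_norm, add_sub_cancel_left, Complex.norm_real, Real.norm_eq_abs,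
        abs_of_pos (half_pos hε)]
      exact half_lt_self hε
    refine ⟨ch.symm (ℓ.symm (c + (ε / 2 : ℝ))), fun h0 ↦ ?_⟩
    have h2 : ch (ch.symm (ℓ.symm (c + (ε / 2 : ℝ)))) = ch p := by rw [h0]
    rw [ch.right_inv hmem] at h2
    have h3 := congrArg ℓ h2
    rw [ℓ.apply_symm_apply, ← hc, add_eq_left, Complex.ofReal_eq_zero] at h3
    linarith
  -- the kernel of the Laurent-jet map: functions holomorphic at `p` too, i.e. constants
  have hker : ∀ v : V, σ v = 0 → (v : M → ℂ) x₀ = 0 → v = 0 := by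
    intro v hv hv0
    obtain ⟨G, hG, hvG⟩ := hV2 v v.2
    have h0 : ∀ i < N, iteratedDeriv i G c = 0 := fun i hi ↦ by
      have h := congr_fun hv ⟨i, hi⟩
      simp only [σ, LinearMap.coe_mk, AddHom.coe_mk, Pi.zero_apply] at h
      rw [hσG v v.2 G hG hvG i] at h
      exact (mul_eq_zero.1 h).resolve_left (inv_ne_zero (by exact_mod_cast i.factorial_ne_zero))
    obtain ⟨G₁, hG₁, hHG₁⟩ := exists_analyticAt_eventuallyEq_of_iteratedDeriv_eq_zero hG hvG h0
    set k : M → ℂ := Function.update (v : M → ℂ) p (G₁ c) with hk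
    have hkv : ∀ x, x ≠ p → k x = (v : M → ℂ) x := fun x hx ↦ Function.update_of_ne hx _ _
    -- `k = G₁ ∘ ℓ ∘ chart` near `p`
    have hkp : k =ᶠ[𝓝 p] fun x ↦ G₁ (ℓ (ch x)) := by
      have hcont : ContinuousAt (fun x ↦ ℓ (ch x)) p :=
        ℓ.continuous.continuousAt.comp (continuousAt_extChartAt p)
      have h1' : ∀ᶠ z in 𝓝 c, z ≠ c → (v : M → ℂ) (ch.symm (ℓ.symm z)) = G₁ z :=
        eventually_nhdsWithin_iff.1 hHG₁
      have h2' : ∀ᶠ x in 𝓝 p, ℓ (ch x) ≠ c → (v : M → ℂ) (ch.symm (ℓ.symm (ℓ (ch x)))) = G₁ (ℓ (ch x)) :=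
        hcont.eventually (p := fun z ↦ z ≠ c → (v : M → ℂ) (ch.symm (ℓ.symm z)) = G₁ z) h1'
      filter_upwards [h2', extChartAt_source_mem_nhds (I := 𝓘(ℝ, E)) p] with x hx hxs
      by_cases hxp : x = p
      · rw [hxp, hk, Function.update_self]
      · have hne : ℓ (ch x) ≠ c := by
          intro he
          apply hxp
          have he' := ℓ.injective he
          rw [← ch.left_inv hxs, he', ch.left_inv (mem_extChartAt_source p)]
        have h3 := hx hne
        rw [ℓ.symm_apply_apply, ch.left_inv hxs] at h3
        rw [hkv x hxp, h3]
    have hkhol : MDifferentiable 𝓘(ℂ, E) 𝓘(ℂ, ℂ) k := by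
      intro x
      by_cases hxp : x = p
      · rw [hxp]
        have hG₁d : DifferentiableAt ℂ (fun y : E ↦ G₁ (ℓ y)) (ch p) :=
          hG₁.differentiableAt.comp _ ℓ.differentiableAt
        have hcomp : MDifferentiableAt 𝓘(ℂ, E) 𝓘(ℂ, ℂ) (fun x ↦ G₁ (ℓ (ch x))) p :=
          hG₁d.mdifferentiableAt.comp p (mdifferentiableAt_extChartAt (mem_chart_source E p))
        exact hcomp.congr_of_eventuallyEq hkp
      · have hkx : k =ᶠ[𝓝 x] (v : M → ℂ) := by
          filter_upwards [isOpen_compl_singleton.mem_nhds hxp] with x' hx' using hkv x' hx'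
        exact (hV1 v v.2 x hxp).congr_of_eventuallyEq hkx
    obtain ⟨κ, hκ⟩ := hkhol.exists_eq_const_of_compactSpace
    have hκ0 : κ = 0 := by
      have h := congr_fun hκ x₀
      rw [hkv x₀ hx₀, hv0] at h
      exact h.symm
    have hv' : (v : M → ℂ) = 0 := hV3 v v.2 fun x hx ↦ by
      rw [← hkv x hx, hκ, hκ0]
      rfl
    exact Subtype.ext hv'
  have hkfin : finrank ℂ (LinearMap.ker σ) ≤ 1 := by
    let ev : LinearMap.ker σ →ₗ[ℂ] ℂ :=
      (LinearMap.proj x₀).comp (V.subtype.comp (LinearMap.ker σ).subtype)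
    have hinj : Function.Injective ev := by
      intro a b hab
      have h0 : σ ((a - b : LinearMap.ker σ) : V) = 0 := LinearMap.mem_ker.1 (a - b).2
      have h3 : (((a - b : LinearMap.ker σ) : V) : M → ℂ) x₀ = 0 := by
        change ((a : V) : M → ℂ) x₀ = ((b : V) : M → ℂ) x₀ at hab
        simp only [Submodule.coe_sub, Pi.sub_apply, hab, sub_self]
      have h4 := hker _ h0 h3
      rw [Submodule.coe_eq_zero] at h4
      exact sub_eq_zero.1 h4
    calc finrank ℂ (LinearMap.ker σ) ≤ finrank ℂ ℂ := LinearMap.finrank_le_finrank_of_injective hinj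
      _ = 1 := Module.finrank_self ℂ
  have hcount := finrank_add_finrank_le_of_sum_mul_rev_eq_zero (LinearMap.range σ)
    (LinearMap.range τ) hpair
  have hτr : finrank ℂ (LinearMap.range τ) = finrank ℂ W := LinearMap.finrank_range_of_inj hτ
  have hσr := LinearMap.finrank_range_add_finrank_ker σ
  omega

end Count

/-! ### `dim H^{1,0} ≤ g` -/

section Hodge

variable {E : Type*} [NormedAddCommGroup E] [NormedSpace ℂ E] [FiniteDimensional ℂ E]
  [MeasurableSpace E] [BorelSpace E]
  {M : Type*} [TopologicalSpace M] [ChartedSpace E M]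
  [IsManifold 𝓘(ℂ, E) ω M] [IsManifold 𝓘(ℝ, E) ∞ M] [T2Space M] [CompactSpace M]
  [PreconnectedSpace M]

/-- **`rank H^{1,0}(M) ≤ g` and `dim H^{1,0}(M) ≤ g`** for the Hodge piece
`hodgePQ E M 1 1 0 ⊆ H¹_dR(M; ℂ)` (the span of the classes of closed smooth `(1,0)`-forms) of a
compact connected complex curve carrying, at one point `p` and for every `N`, a space of functions
holomorphic off `p` with a pole of order `≤ N` at `p` of dimension `≥ N + 1 − g`
(`finrank_le_of_forall_exists_poleSpace` applied to the spans of linearly independent families of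
closed `(1,0)`-forms; the class map is linear). In print: `dim H⁰(X, Ω) = g`
(Forster, *Lectures on Riemann Surfaces*, Thm. 16.9 / 17.12; Griffiths–Harris, p. 245), of which
this is the inequality `≤` in the form needed on the tree's carriers.
[cite: FarkasKra1992, I.1.5 and II.5.3] [cite: HormanderSCV1973, Thm. 1.2.1] -/
theorem rank_hodgePQ_one_one_zero_le (h1 : finrank ℂ E = 1) [Fact (finrank ℝ E = 2)]
    (ℓ : E ≃L[ℂ] ℂ) (p : M) {g : ℕ}
    (hV : ∀ N : ℕ, ∃ V : Submodule ℂ (M → ℂ),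
      (∀ h ∈ V, ∀ x, x ≠ p → MDifferentiableAt 𝓘(ℂ, E) 𝓘(ℂ, ℂ) h x) ∧
      (∀ h ∈ V, ∃ G : ℂ → ℂ, AnalyticAt ℂ G (ℓ (extChartAt 𝓘(ℝ, E) p p)) ∧
        ∀ᶠ z in 𝓝[≠] (ℓ (extChartAt 𝓘(ℝ, E) p p)),
          h ((extChartAt 𝓘(ℝ, E) p).symm (ℓ.symm z)) =
            (z - ℓ (extChartAt 𝓘(ℝ, E) p p)) ^ (-(N : ℤ)) * G z) ∧
      (∀ h ∈ V, (∀ x, x ≠ p → h x = 0) → h = 0) ∧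
      FiniteDimensional ℂ V ∧ N + 1 ≤ finrank ℂ V + g) :
    Module.rank ℂ (hodgePQ E M 1 1 0) ≤ g ∧ finrank ℂ (hodgePQ E M 1 1 0) ≤ g := by
  classical
  -- the closed smooth `(1,0)`-forms as a submodule `Ω` of `Z¹(M; ℂ)` (kept opaque)
  obtain ⟨Ω, hΩmem⟩ : ∃ Ω : Submodule ℂ (cclosedSmoothForms E M 1),
      ∀ α, α ∈ Ω ↔ IsOfType 1 0 (α : MForm 𝓘(ℝ, E) M ℂ 1) :=
    ⟨{ carrier := {α | IsOfType 1 0 (α : MForm 𝓘(ℝ, E) M ℂ 1)}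
       add_mem' := fun ha hb ↦ ha.add hb
       zero_mem' := isOfType_zero rfl
       smul_mem' := fun c _ hα ↦ hα.smul c }, fun α ↦ Iff.rfl⟩
  have hΩ : hodgePQ E M 1 1 0 = Ω.map (complexDeRhamCohomology.mk E M 1) := by
    rw [hodgePQ, show {α : cclosedSmoothForms E M 1 | IsOfType 1 0 (α : MForm 𝓘(ℝ, E) M ℂ 1)} =
      (Ω : Set (cclosedSmoothForms E M 1)) from Set.ext fun α ↦ (hΩmem α).symm,
      Submodule.span_image, Submodule.span_eq]
  -- the same forms as a submodule `P` of `MForm`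
  set P : Submodule ℂ (MForm 𝓘(ℝ, E) M ℂ 1) := Ω.map (cclosedSmoothForms E M 1).subtype with hPdef
  have hP : ∀ α ∈ P, IsSmoothForm α ∧ IsClosedForm α ∧ IsOfType 1 0 α := by
    rintro _ ⟨β, hβ, rfl⟩
    obtain ⟨hs, hc⟩ := (mem_cclosedSmoothForms_iff (β : MForm 𝓘(ℝ, E) M ℂ 1)).1 β.2
    exact ⟨hs, hc, (hΩmem β).1 hβ⟩
  have hPΩ : Module.rank ℂ Ω = Module.rank ℂ P :=
    LinearEquiv.rank_eq (Submodule.equivMapOfInjective _ (Submodule.injective_subtype _) Ω)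
  have hrankP : Module.rank ℂ P ≤ g := by
    refine rank_le fun s hs ↦ ?_
    let f : s → MForm 𝓘(ℝ, E) M ℂ 1 := fun i ↦ ((i : P) : MForm 𝓘(ℝ, E) M ℂ 1)
    have hf : LinearIndependent ℂ f := hs.map' P.subtype (Submodule.ker_subtype P)
    set W : Submodule ℂ (MForm 𝓘(ℝ, E) M ℂ 1) := Submodule.span ℂ (Set.range f) with hWdef
    haveI : FiniteDimensional ℂ W := FiniteDimensional.span_of_finite ℂ (Set.finite_range f)
    have hWP : W ≤ P := by
      refine Submodule.span_le.2 ?_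
      rintro _ ⟨i, rfl⟩
      exact (i : P).2
    have hW : ∀ α ∈ W, IsSmoothForm α ∧ IsClosedForm α ∧ IsOfType 1 0 α := fun α hα ↦ hP α (hWP hα)
    have hle := finrank_le_of_forall_exists_poleSpace h1 ℓ p hV W hW
    have hcard : finrank ℂ W = s.card := by
      rw [hWdef, finrank_span_eq_card hf, Fintype.card_coe]
    omega
  have hrank' : Module.rank ℂ (hodgePQ E M 1 1 0) ≤ g := by
    rw [hΩ]
    exact (rank_map_le _ _).trans (hPΩ ▸ hrankP)
  exact ⟨hrank', finrank_le_of_rank_le hrank'⟩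

end Hodge

end Literature.Geometry.Kaehler

end
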